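import Summits.Ventures.PercRepro.S2CoreSeventeenSplit

/-!
# PercRepro — S2: THE COLOOP STEP, SHARPENED (p7, gen 11; sub-claim S2)

The kit's coloop step `weighted_of_isColoop_scaled` (S2CoreSeventeenSplit) drops two terms of the identity
`#Y(p + 1, q + 1) = 2·#Y'(p, q + 1) + #{ρ' = p} + #{ρ' = q + 1}` (`midCount_eq_of_isColoop_q`, `' = M ＼ e`) and asks the scaled
cell `Φ/2 · #U' ≤ #Y'`. Both dropped terms are `≥ #U'` — a top set is a rank-`(q + 1)` set (`topCount_le_levelCount_bot`) and the
complement of a spanning set (`topCount_le_levelCount_top`) — so the scaled cell may be asked with `(Φ − 2)/2` in place of `Φ/2`: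
**`weighted_of_isColoop_scaled_sharp`**. Iterated `c` times the weight becomes `Φ/2^c − 2 + 2^{1−c}` (**`weighted_of_isColoop_scaled_sharp_iter`**
spells out the two-coloop case: `(Φ − 6)/4`). At `Φ(15, 5) = 389/6` this moves the scaled cells' `K` from `16173` to
`16688` (one coloop) and `17822` (two) — the margin the coloop chains of `(15, 8)` / `(15, 9)` need (S2 v33 §R3⁗(r)(5)(c)).
Generic in `(p, q)`; nothing else of the kit changes. Axioms: standard.
-/

open scoped Matroid

namespace PercRepro

namespace ThmN

variable {α : Type}

/-- **The coloop step, scaled and sharpened**: `e` a coloop, `r(M) = p + 1`, `q + 1 < p`; if `M ＼ {e}` satisfies the scaled cell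
with the weight `(Φ − 2)/2`, then `M` satisfies the weighted inequality with `Φ` at `(p + 1, q + 1)`. -/
theorem weighted_of_isColoop_scaled_sharp (M : Matroid α) [M.Finite] {e : α} (he : M.IsColoop e) {p q : ℕ}
    (hp : q + 1 < p) (hR : M.eRank = ((p + 1 : ℕ) : ℕ∞)) (Φ : ℚ)
    (h : (Φ - 2) / 2 * (Matroid.topCount (M ＼ {e}) p (q + 1) : ℚ) ≤ (Matroid.midCount (M ＼ {e}) p (q + 1) : ℚ)) :
    Φ * (Matroid.topCount M (p + 1) (q + 1) : ℚ) ≤ (Matroid.midCount M (p + 1) (q + 1) : ℚ) := by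
  rw [Matroid.topCount_eq_of_isColoop_of_eRank he q hR, Matroid.midCount_eq_of_isColoop_q he hp]
  push_cast
  have h1 : (Matroid.topCount (M ＼ {e}) p (q + 1) : ℚ) ≤ (Matroid.levelCount (M ＼ {e}) p : ℚ) := by
    exact_mod_cast Matroid.topCount_le_levelCount_top p (q + 1)
  have h2 : (Matroid.topCount (M ＼ {e}) p (q + 1) : ℚ) ≤ (Matroid.levelCount (M ＼ {e}) (q + 1) : ℚ) := by
    exact_mod_cast Matroid.topCount_le_levelCount_bot p (q + 1)
  linarith [h, h1, h2]

/-- **Two coloops**: `e` a coloop of `M`, `f` a coloop of `M ＼ {e}`, `r(M) = p + 2`, `q + 1 < p`; the twice-scaled cell with the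
weight `(Φ − 6)/4` on `M ＼ {e} ＼ {f}` gives the weighted inequality with `Φ` at `(p + 2, q + 1)`. -/
theorem weighted_of_isColoop_scaled_sharp_iter (M : Matroid α) [M.Finite] {e f : α} (he : M.IsColoop e)
    (hf : (M ＼ {e}).IsColoop f) {p q : ℕ} (hp : q + 1 < p) (hR : M.eRank = ((p + 2 : ℕ) : ℕ∞)) (Φ : ℚ)
    (h : (Φ - 6) / 4 * (Matroid.topCount ((M ＼ {e}) ＼ {f}) p (q + 1) : ℚ) ≤
      (Matroid.midCount ((M ＼ {e}) ＼ {f}) p (q + 1) : ℚ)) :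
    Φ * (Matroid.topCount M (p + 2) (q + 1) : ℚ) ≤ (Matroid.midCount M (p + 2) (q + 1) : ℚ) := by
  have hR' : (M ＼ {e}).eRank = ((p + 1 : ℕ) : ℕ∞) := by
    have heE : e ∈ M.E := he.mem_ground
    have h1 : M.eRk ((M.E \ {e}) ∪ {e}) = M.eRk (M.E \ {e}) + ({e} : Set α).encard :=
      eRk_union_eq_of_subset_coloops Set.sdiff_subset (Set.singleton_subset_iff.2 he) Set.disjoint_sdiff_left
    rw [Set.sdiff_union_of_subset (Set.singleton_subset_iff.2 heE), ← Matroid.eRank_def, hR,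
      Set.encard_singleton] at h1
    rw [Matroid.delete_eq_restrict, Matroid.eRank_restrict]
    have h2 : M.eRk (M.E \ {e}) + 1 = ((p + 1 : ℕ) : ℕ∞) + 1 := by
      rw [← h1]; push_cast; ring
    exact WithTop.add_right_cancel (by norm_num : (1 : ℕ∞) ≠ ⊤) h2
  have hinner := weighted_of_isColoop_scaled_sharp (M ＼ {e}) hf hp hR' ((Φ - 2) / 2)
    (by
      have e4 : ((Φ - 2) / 2 - 2) / 2 = (Φ - 6) / 4 := by ring
      rw [e4]; exact h)
  exact weighted_of_isColoop_scaled_sharp M he (by omega) (by rw [hR]) Φ hinner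

end ThmN

end PercRepro
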